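import Summits.BirchSwinnertonDyer.BirchSwinnertonDyer.Theorems.SignedBaseChangeTwistPairGreenbergProductDivisibilityStubFrameDataBCS
import HarnessLib

/-!
# K1′ `TwistPairGreenbergProductDivisibilitySplit` (stmt-BirchSwinnertonDyer-20502), line `birth` v6 (`p` SPLIT in `F`):
# registered stub `stub_frameDataBCSsplit` — K1's arithmetic frame WITH the base-change splitting package in the
# `p`-split-in-`F` variant (helper `--supports` 20502; lead sbc-p1 g3)

The tenure planner's anatomy of the one open stub of K1′ (memo `K1PRIME-LINE-MEMO-v1.md` §3, crux-idea card
`definite-bf-transplant`) identifies three gaps G1–G3 of the Castella–Liu–Wan engine transplanted to the real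
quadratic field `F = ℚ(√d)`; G3 ("the non-ordinary local doubling computation at a prime of `F` with residue
field `𝔽_{p²}`") is AVOIDED by choosing `p` SPLIT in `F` — Wan 2015 Thm. 4 asks only "`p` unramified in `F`",
and Burungale–Castella–Skinner 2025 Prop. 5.2.1 (i) "`p` inert in `F`" is stricter than its source needs (memo
F2). The landed frame lemma `SignedBaseChangeK1FrameDataBCS.stub_frameDataBCS` (p514288, line `birth` v4) chose
`d` a NON-residue mod `p` (`p` inert in `F`). This file is the `p`-split twin: the SAME 24 conjuncts except that
`¬ IsSquare (d : ZMod p)` becomes `(d : ZMod p) ≠ 0 ∧ IsSquare (d : ZMod p)` (`p` split in `ℚ(√d)`), proved by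
the same CRT + Dirichlet choice of the twist prime `d = ℓ ≡ 1 (mod 8)` with `p` moved from the non-residue set
to the residue set (`ℓ ≡ 1 (mod p)`). It is the `∃` half of the reshaped skeleton `birth` v6 whose open stub
`stub_productDivisibilityBCSsplit` is the G3-free form of the crux's content. Bookkeeping only; no new definition.
-/

-- D-0017: single-problem summit, the namespace repeats the problem name by design.
set_option linter.dupNamespace false
set_option autoImplicit false

noncomputable section

open scoped Classical
open NumberField IsDedekindDomain Field WeierstrassCurve
open Literature.NumberTheory.EllipticCurves Literature.NumberTheory.GaloisRepresentations
  Literature.NumberTheory.EllipticCurves.ModularForms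
open Summit.BirchSwinnertonDyer.BirchSwinnertonDyer.Theorems.SignedBaseChangeK1FrameData
open Summit.BirchSwinnertonDyer.BirchSwinnertonDyer.Theorems.SignedBaseChangeK1FrameDataBCS

namespace Summit.BirchSwinnertonDyer.BirchSwinnertonDyer.Theorems.SignedBaseChangeK1FrameDataBCSSplit

/-- **`stub_frameDataBCSsplit` of line `birth` v6 (crux K1′, stmt-BirchSwinnertonDyer-20502), VERBATIM the
registered signature.** For every globally minimal `W/ℚ`, prime `p ≥ 5` with `ClassX7 W p` and `Surj W p`,
granted modularity with parametrisation: K1's frame data exist together with the base-change splitting package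
— (Heeg) and `2` split in `K`, `d_K` odd `≠ −3`, `d ≡ 1 (mod 8)`, primes of `d` split in `K`, `d` a NON-ZERO
SQUARE mod `p` (`p` split in `F = ℚ(√d)`), and for odd `ℓ ∣ N`: `d` a non-zero square mod `ℓ` iff `p ∤ ℓ + 1`. -/
theorem stub_frameDataBCSsplit : Literature.NumberTheory.EllipticCurves.ModularForms.nonempty_modularParametrizationData → ∀ (W : WeierstrassCurve ℚ) [W.IsElliptic] [W.IsGloballyMinimal] (p : ℕ) [Fact p.Prime], 5 ≤ p → Literature.NumberTheory.EllipticCurves.Rank1Residual.ClassX7 W p → Literature.NumberTheory.EllipticCurves.Rank1Residual.Surj W p → ∃ (K : Type) (_ : Field K) (_ : NumberField K) (ι : PadicAlgCl p ≃+* ℂ) (v vbar : IsDedekindDomain.HeightOneSpectrum (NumberField.RingOfIntegers K)) (κ₁ κ₂ : Literature.NumberTheory.EllipticCurves.ZpExtension K p) (γ₁ γ₂ : Field.absoluteGaloisGroup K) (_ : Fact (Literature.NumberTheory.EllipticCurves.ZpExtension.IsTopGeneratorPair κ₁ κ₂ γ₁ γ₂)) (_ : NeZero (NumberField.discr K).natAbs)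 (N : ℕ) (_ : NeZero N) (f : CuspForm (CongruenceSubgroup.Gamma0 N) 2) (d : ℤ) (W' : WeierstrassCurve ℚ) (_ : W'.IsElliptic) (_ : W'.IsGloballyMinimal) (C : WeierstrassCurve.VariableChange ℚ) (N' : ℕ) (_ : NeZero N') (f' : CuspForm (CongruenceSubgroup.Gamma0 N') 2), Literature.NumberTheory.EllipticCurves.ModularForms.IsNewformOf W f ∧ (N : ℤ) = W.conductorNorm ℤ ∧ Literature.NumberTheory.EllipticCurves.ModularForms.IsNewformOf W' f' ∧ (N' : ℤ) = W'.conductorNorm ℤ ∧ Squarefree d ∧ 1 < d ∧ (∀ q : ℕ, q.Prime → Literature.NumberTheory.EllipticCurves.BurungaleSkinnerTianWan2024.RamifiedInQuadratic d q → q ≠ p ∧ ¬ q ∣ N ∧ ¬ (q : ℤ) ∣ NumberField.discr K) ∧ C • W' = W.quadraticTwist (d : ℚ) ∧ Literature.NumberTheory.EllipticCurves.IsImaginaryQuadratic K ∧ ((Ideal.span {(p : ℤ)}).primesOver (NumberField.RingOfIntegers K)).ncard = 2 ∧ ((p : ℕ) : NumberField.RingOfIntegers K) ∈ v.asIdeal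 ∧ ((p : ℕ) : NumberField.RingOfIntegers K) ∈ vbar.asIdeal ∧ vbar ≠ v ∧ (∀ (w : NumberField.InfinitePlace K) (k : NumberField.RingOfIntegers K), k ∈ v.asIdeal ↔ ‖ι.symm (w.embedding (k : K))‖ < 1) ∧ IsCoprime (N : ℤ) (NumberField.discr K) ∧ (∀ ρ : Literature.NumberTheory.GaloisRepresentations.ModPGaloisRep K (ZMod p) 2, (W.baseChange K).IsTorsionGaloisRep p ρ → Literature.NumberTheory.GaloisRepresentations.FramedRep.IsAbsolutelyIrreducible ρ) ∧ κ₁.IsCyclotomic ∧ κ₂.IsAnticyclotomic ∧ (∀ ℓ : ℕ, ℓ.Prime → ℓ ∣ N → ((Ideal.span {(ℓ : ℤ)}).primesOver (NumberField.RingOfIntegers K)).ncard = 2) ∧ ((Ideal.span {(2 : ℤ)}).primesOver (NumberField.RingOfIntegers K)).ncard = 2 ∧ (Odd (NumberField.discr K) ∧ NumberField.discr K ≠ -3) ∧ d % 8 = 1 ∧ (∀ ℓ : ℕ, ℓ.Prime → (ℓ : ℤ) ∣ d → ((Ideal.span {(ℓ : ℤ)}).primesOver (NumberField.RingOfIntegers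 K)).ncard = 2) ∧ (((d : ℤ) : ZMod p) ≠ 0 ∧ IsSquare ((d : ℤ) : ZMod p)) ∧ (∀ ℓ : ℕ, ℓ.Prime → ℓ ∣ N → ℓ ≠ 2 → ((d : ℤ) : ZMod ℓ) ≠ 0 ∧ (IsSquare ((d : ℤ) : ZMod ℓ) ↔ ¬ p ∣ ℓ + 1)) := by
  intro hmodP W _ _ p _ hp hX hs
  have hpP : p.Prime := Fact.out
  have hp2 : p ≠ 2 := by omega
  -- the newform of `W`; `p ∤ N` (good reduction at `p`)
  haveI hN0 : NeZero (W.conductorNorm ℤ) := ⟨(WeierstrassCurve.conductorNorm_pos_holds W).ne'⟩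
  obtain ⟨D⟩ := hmodP W
  set N : ℕ := W.conductorNorm ℤ with hNdef
  have hpN : ¬ p ∣ N := not_dvd_conductorNorm_of_hasGoodReductionAtPrime W hX.1.1
  -- §1 the twist prime `ℓ`: residues prescribed at `p` and at the odd primes of `N`
  set A : Finset ℕ := insert p ((N.primeFactors.erase 2).filter (fun ℓ ↦ ¬ p ∣ ℓ + 1)) with hAdef
  set B : Finset ℕ := (N.primeFactors.erase 2).filter (fun ℓ ↦ p ∣ ℓ + 1) with hBdef
  have hmemE : ∀ ℓ ∈ N.primeFactors.erase 2, ℓ.Prime ∧ ℓ ≠ 2 ∧ ℓ ∣ N := fun ℓ hℓ ↦ by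
    rw [Finset.mem_erase, Nat.mem_primeFactors] at hℓ
    exact ⟨hℓ.2.1, hℓ.1, hℓ.2.2.1⟩
  have hA : ∀ a ∈ A, a.Prime ∧ a ≠ 2 := fun a ha ↦ by
    rw [hAdef, Finset.mem_insert] at ha
    rcases ha with rfl | ha
    · exact ⟨hpP, hp2⟩
    · rw [Finset.mem_filter] at ha
      exact ⟨(hmemE a ha.1).1, (hmemE a ha.1).2.1⟩
  have hB : ∀ b ∈ B, b.Prime ∧ b ≠ 2 := fun b hb ↦ by
    rw [hBdef, Finset.mem_filter] at hb
    exact ⟨(hmemE b hb.1).1, (hmemE b hb.1).2.1⟩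
  have hAB : Disjoint A B := by
    rw [Finset.disjoint_left]
    intro a haA haB
    rw [hAdef, Finset.mem_insert] at haA
    rw [hBdef, Finset.mem_filter] at haB
    rcases haA with rfl | haA
    · exact hpN (hmemE _ haB.1).2.2
    · rw [Finset.mem_filter] at haA
      exact haA.2 haB.2
  obtain ⟨ℓ, hℓ, hℓgt, -, -, hℓ8, hℓA, hℓB⟩ := exists_prime_one_mod_eight_prescribed A B hA hB hAB (N + p)
  have hℓ4 : ℓ ≡ 1 [MOD 4] := by unfold Nat.ModEq; omega
  -- the field: `2`, `p`, `ℓ` and the primes of `N` split, `d_K = -q` with `q > N + p + ℓ`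
  obtain ⟨K, _, _, q, h2K, htc, hq, hnq, -, hq8, hdisc, hsplitT, -⟩ :=
    Literature.NumberTheory.QuadraticFields.Quadratic.exists_imaginaryQuadratic_forall_split
      (insert 2 (insert p (insert ℓ N.primeFactors))) (N + p + ℓ)
  have hK : IsImaginaryQuadratic K := ⟨h2K, htc⟩
  have hTN : ∀ l : ℕ, l.Prime → l ∣ N →
      ((Ideal.span {(l : ℤ)}).primesOver (𝓞 K)).ncard = 2 := fun l hl hlN ↦
    hsplitT l (by simp [Nat.mem_primeFactors, hl, hlN, hN0.out]) hl
  have hsplit : ((Ideal.span {(p : ℤ)}).primesOver (𝓞 K)).ncard = 2 := hsplitT p (by simp) hpP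
  have hsplitℓ : ((Ideal.span {(ℓ : ℤ)}).primesOver (𝓞 K)).ncard = 2 := hsplitT ℓ (by simp) hℓ
  have hsplit2 : ((Ideal.span {(2 : ℤ)}).primesOver (𝓞 K)).ncard = 2 := by
    exact_mod_cast hsplitT 2 (by simp) Nat.prime_two
  -- places above `p`, embedding datum, tower
  obtain ⟨v, vbar, hv, hvbar, hne⟩ := exists_pair_of_ncard_primesOver_eq_two hpP hsplit
  obtain ⟨ι, hι⟩ := exists_iota hK v hv
  obtain ⟨κ₁, κ₂, γ₁, γ₂, hpair, hcyc, hanti⟩ :=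
    exists_isTopGeneratorPair_isCyclotomic_isAnticyclotomic (p := p) hK hp2
  haveI : Fact (ZpExtension.IsTopGeneratorPair κ₁ κ₂ γ₁ γ₂) := ⟨hpair⟩
  haveI : NeZero (NumberField.discr K).natAbs :=
    ⟨by rw [hdisc, Int.natAbs_neg, Int.natAbs_natCast]; exact hq.ne_zero⟩
  -- the twist `W^{(ℓ)}` and its minimal model
  have hℓ0 : ((ℓ : ℤ) : ℚ) ≠ 0 := by exact_mod_cast hℓ.ne_zero
  haveI := W.isElliptic_quadraticTwist hℓ0
  obtain ⟨C₀, hC₀⟩ := WeierstrassCurve.hasGlobalMinimalModel_rat_holds (W.quadraticTwist ((ℓ : ℤ) : ℚ))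
  haveI : (C₀ • W.quadraticTwist ((ℓ : ℤ) : ℚ)).IsGloballyMinimal := hC₀
  haveI hN0' : NeZero ((C₀ • W.quadraticTwist ((ℓ : ℤ) : ℚ)).conductorNorm ℤ) :=
    ⟨(WeierstrassCurve.conductorNorm_pos_holds _).ne'⟩
  obtain ⟨D'⟩ := hmodP (C₀ • W.quadraticTwist ((ℓ : ℤ) : ℚ))
  refine ⟨K, inferInstance, inferInstance, ι, v, vbar, κ₁, κ₂, γ₁, γ₂, inferInstance, inferInstance, N,
    inferInstance, D.f, (ℓ : ℤ), C₀ • W.quadraticTwist ((ℓ : ℤ) : ℚ), inferInstance, hC₀, C₀⁻¹,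
    (C₀ • W.quadraticTwist ((ℓ : ℤ) : ℚ)).conductorNorm ℤ, inferInstance, D'.f, D.isNewformOf, rfl,
    D'.isNewformOf, rfl, ?_, ?_, ?_, inv_smul_smul C₀ _, hK, hsplit, hv, hvbar, hne, hι, ?_, ?_, hcyc, hanti,
    hTN, hsplit2, ?_, ?_, ?_, ?_, ?_⟩
  · -- `ℓ` square-free
    exact Int.squarefree_natCast.mpr hℓ.squarefree
  · -- `1 < ℓ`
    exact_mod_cast hℓ.one_lt
  · -- ramified in `ℚ(√ℓ)` only at `ℓ`, and `ℓ ∤ p N d_K`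
    intro q' hq' hram
    obtain rfl := eq_of_ramifiedInQuadratic hℓ hℓ4 hq' hram
    refine ⟨by omega, fun h ↦ ?_, fun h ↦ ?_⟩
    · exact absurd (Nat.le_of_dvd (Nat.pos_of_ne_zero hN0.out) h) (by omega)
    · rw [hdisc, Int.dvd_neg, Int.natCast_dvd_natCast, Nat.prime_dvd_prime_iff_eq hq' hq] at h
      omega
  · -- `(N, d_K) = 1`
    rw [hdisc]
    exact isCoprime_of_lt hq hN0.out (by omega)
  · -- (irr_K), framed
    exact fun ρ hρ ↦ irrK_framed_of_surj W p hp2 hs K hK.1 ρ hρ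
  · -- (disc): `d_K = -q` odd and `≠ -3`
    refine ⟨?_, ?_⟩
    · rw [hdisc, Int.odd_iff]; omega
    · rw [hdisc]; omega
  · -- `d ≡ 1 (mod 8)`
    omega
  · -- the primes of `d = ℓ` split in `K`
    intro l hl hdvd
    obtain rfl : l = ℓ := (Nat.prime_dvd_prime_iff_eq hl hℓ).mp (Int.natCast_dvd_natCast.mp hdvd)
    exact hsplitℓ
  · -- `d ≡ 1` is a non-zero square mod `p` (`p` SPLIT in `ℚ(√d)`)
    rw [Int.cast_natCast, hℓA p (by rw [hAdef]; exact Finset.mem_insert_self _ _)]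
    exact ⟨one_ne_zero, ⟨1, (mul_one 1).symm⟩⟩
  · -- odd `ℓ' ∣ N`: `d` a non-zero square mod `ℓ'` iff `p ∤ ℓ' + 1`
    intro l hl hlN hl2
    haveI : Fact l.Prime := ⟨hl⟩
    have hlE : l ∈ N.primeFactors.erase 2 := by
      rw [Finset.mem_erase, Nat.mem_primeFactors]; exact ⟨hl2, hl, hlN, hN0.out⟩
    rw [Int.cast_natCast]
    by_cases hpl : p ∣ l + 1
    · have hlB : l ∈ B := by
        rw [hBdef, Finset.mem_filter]; exact ⟨hlE, hpl⟩
      obtain ⟨hne0, hnsq⟩ := hℓB l hlB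
      exact ⟨hne0, iff_of_false hnsq (not_not.mpr hpl)⟩
    · have hlA : l ∈ A := by
        rw [hAdef, Finset.mem_insert, Finset.mem_filter]; exact Or.inr ⟨hlE, hpl⟩
      rw [hℓA l hlA]
      exact ⟨one_ne_zero, iff_of_true ⟨1, (mul_one 1).symm⟩ hpl⟩

end Summit.BirchSwinnertonDyer.BirchSwinnertonDyer.Theorems.SignedBaseChangeK1FrameDataBCSSplit

end
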